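import Summits.QuantumFields.YangMills.Theorems.UnitScaleTiltProp7TrueLinSourcedStructure
import Summits.QuantumFields.YangMills.Theorems.UnitScaleTiltProp7TrueLinIterDefect
import Summits.QuantumFields.YangMills.Theorems.UnitScaleTiltProp7CovIterLambdaEnergy
import Summits.QuantumFields.YangMills.Theorems.UnitScaleTiltProp7CurvedLandauCoercivity
import HarnessLib

/-!
# Route `UnitScaleTilt`, crux K1 «MinimiserStabilityRegPr» (stmt-QuantumFields-19200), route-R [RP] curved, the `Q`-junction (R2), file A2 —
# THE SOURCED STRUCTURE RECURSION IN `ℓ²`: `‖D_k‖_{ℓ²} ≤ e^{(κ/ρ)Σa}·(Σ_{j<k} ρ^{k−1−j}‖R_j‖_{ℓ²} + 2√d·C_CM·Σ_{j<k}Σ_{i<j} ρ^{j−1−i}‖R_i‖_{ℓ²})`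
# for `D_0 = 0`, `D_{j+1} = T_jD_j + R_j` along the background tower — per-level `ℓ²` sizes of the sources ADD with the bricks' geometric weights

Cell `ym3-torus`, keyed width hand `ym-routeR-w3` (D-0154 (3c); (R2) LOCATED 2026-08-28 08:42Z).  Sequel of file A1 ✓ `…TrueLinSourcedStructure` (the split
`D_j = G^D_j + P_{Ū₀^{(j)}}Λ^D_j` with sources).  THEOREMS ONLY (0 `def`, 0 `sorry`); `--supports stmt-QuantumFields-19200`, count-neutral.  YM₃ on T³ is a ladder rung (R3),
not the Clay problem; nothing here claims the stub, the crux, d = 4 or the mass gap.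

THE POINT.  With the sourced reduced family `G^D_{j+1} = LINE_j(G^D_j) + Def_j(G^D_j) + R_j` (`G^D_0 = 0`) the bricks' `ℓ²` rows (✓ p606827 `sum_normSq_line_le`:
`‖LINE‖ ≤ ρ = √(L^{2−d})`; ✓ p607412 `sum_normSq_defect_le`: `‖Def_j‖ ≤ κa_j`) give `g_{j+1} ≤ (ρ + κa_j)g_j + r_j`, `r_j = ‖R_j‖_{ℓ²}`, hence
`g_k ≤ e^{(κ/ρ)Σ_{j<k}a_j}·Σ_{j<k}ρ^{k−1−j}r_j` (§1–§2) — OLD SOURCES DECAY like `ρ^{k−1−j}` at `d ≥ 3`.  The coarse gauge function `Λ^D` is bounded by ★routeR-w2's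
Minkowski over the levels (✓ `Prop7CovIterLambdaBound.sqrt_sum_normSq_le_sum_levels`) with a MASS bound of the covariant comb mean — for a source term no Poincaré
is needed: ✓ `Prop7CovCombMeanPoincare.sum_normSq_covCombMean_le` plus `Σ‖∇^VX‖² ≤ 4dΣ‖X‖²` gives `‖CM_j(X)‖_{ℓ²} ≤ C_CM‖X‖_{ℓ²}`,
`C_CM = √(4d(d+2)²NL⁴ + 4(d+2)²d³(3N+2d)L⁶a′²)` (§3).  §4 assembles `‖D_k‖_{ℓ²} ≤ ‖G^D_k‖_{ℓ²} + 2√d·‖Λ^D_k‖_{ℓ²}`.  File B instantiates `R_j` at the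
one-step true-linearisation remainders of the nonlinear (0.4)-fibre (★p1's ✓ `Prop7HolRatioPerStep.norm_avgFun_ratio_sub_one_sub_trueLin_le`).

WHAT IS PROVED (ns `…Theorems.Prop7TrueLinSourcedDefect`; `SU(N)`, any `P`; sizes `a` (loop variables), `a′` (plaquettes) displayed as in ✓ p608741 ∕ ✓ p612184).
* §1 `sourced_recursion_bound` (reals).  §2 ★ `sqrt_sum_normSq_sourcedReduced_le`.  §3 `sum_normSq_covGrad_le_mass`, ★ `sqrt_sum_normSq_sourcedGauge_le`.
* §4 `sqrt_sum_normSq_pureGauge_le`, ★★ `sqrt_sum_normSq_sourced_le`.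
HONEST SCOPE.  Minkowski bookkeeping over the landed bricks; nothing of [Balaban1984PropagatorsI] ∕ [Balaban1985Averaging] is asserted beyond the cited tree theorems.

References: T. Bałaban, CMP 95 (1984) 17–40 [Balaban1984PropagatorsI] ((1.18)–(1.20) pp.19–20); CMP 98 (1985) 17–51 [Balaban1985Averaging] (Prop. 3 (124)–(126) p.36,
(62) p.28); CMP 102 (1985) 277–309 [Balaban1985Variational] (Prop. 7 p.299).
-/

set_option autoImplicit false

noncomputable section

open scoped BigOperators Matrix.Norms.L2Operator

namespace Summit.QuantumFields.YangMills.Theorems.Prop7TrueLinSourcedDefect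

open Literature.MathematicalPhysics.QuantumFieldTheory.Balaban1983to89
open Finset T4Continuum BlockAveraging AveragingRT ExpMeanLog BlockAveragingEMLLinearised BlockAveragingEMLLinearisedBackground BlockAveragingEMLProp2
open Summit.QuantumFields.YangMills.Theorems.Prop7TrueLinLineBound (sum_normSq_line_le)
open Summit.QuantumFields.YangMills.Theorems.Prop7TrueLinDefectBound (sum_normSq_defect_le)
open Summit.QuantumFields.YangMills.Theorems.Prop7TrueLinIterDefect (sqrt_sum_norm_add_sq_le sqrt_le_sqrt_mul_of_sq_le)
open Summit.QuantumFields.YangMills.Theorems.Prop7CovIterLambdaBound (sqrt_sum_normSq_le_sum_levels norm_le_of_rec_eq sqrt_sum_sq_add_le norm_conj_su_le)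
open Summit.QuantumFields.YangMills.Theorems.Prop7CovCombMeanPoincare (sum_normSq_covCombMean_le)
open Summit.QuantumFields.YangMills.Theorems.Prop7TrueLinSourcedStructure (norm_le_of_sourced_structure)
open Summit.QuantumFields.YangMills.Theorems.Prop7PinnedFlatCoercivity (sum_pbond_tgt_add_src)
open Summit.QuantumFields.YangMills.Theorems.Prop7FlatCoercivity (sum_shift)
open B10StarCount (sum_pbond)

variable {P : Params} {N : ℕ} [NeZero N]

/-! ## §1 The real-sequence bound for a sourced contraction -/

omit [NeZero N] in
/-- **SOURCED RECURSION**: `g 0 = 0`, `g (j+1) ≤ (ρ + κ·a j)·g j + r j` (`ρ > 0`, `κ, a j, r j ≥ 0`) ⇒ `g k ≤ exp((κ/ρ)Σ_{j<k}a j)·Σ_{j<k} ρ^{k−1−j}·r j`. [folklore] -/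
theorem sourced_recursion_bound {ρ κ : ℝ} (hρ : 0 < ρ) (hκ : 0 ≤ κ) (a g r : ℕ → ℝ) (ha : ∀ j, 0 ≤ a j) (hg : ∀ j, 0 ≤ g j) (hr : ∀ j, 0 ≤ r j) (hg0 : g 0 = 0) :
    ∀ k : ℕ, (∀ j < k, g (j + 1) ≤ (ρ + κ * a j) * g j + r j) →
      g k ≤ Real.exp (κ / ρ * ∑ j ∈ Finset.range k, a j) * ∑ j ∈ Finset.range k, ρ ^ (k - 1 - j) * r j := by
  intro k
  induction k with
  | zero => intro _; simp [hg0]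
  | succ k ih =>
    intro hgs
    have ihk := ih fun j hj => hgs j (Nat.lt_succ_of_lt hj)
    have hκρ : 0 ≤ κ / ρ := div_nonneg hκ hρ.le
    have hA0 : 0 ≤ ∑ j ∈ Finset.range k, a j := Finset.sum_nonneg fun j _ => ha j
    have hS0 : 0 ≤ ∑ j ∈ Finset.range k, ρ ^ (k - 1 - j) * r j := Finset.sum_nonneg fun j _ => mul_nonneg (pow_nonneg hρ.le _) (hr j)
    have hE1 : 1 ≤ Real.exp (κ / ρ * ∑ j ∈ Finset.range (k + 1), a j) :=
      Real.one_le_exp (mul_nonneg hκρ (Finset.sum_nonneg fun j _ => ha j))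
    have hEs : Real.exp (κ / ρ * ∑ j ∈ Finset.range (k + 1), a j) = Real.exp (κ / ρ * ∑ j ∈ Finset.range k, a j) * Real.exp (κ / ρ * a k) := by
      rw [Finset.sum_range_succ, mul_add, Real.exp_add]
    have hstep : ρ + κ * a k ≤ ρ * Real.exp (κ / ρ * a k) := by
      have h1 : 1 + κ / ρ * a k ≤ Real.exp (κ / ρ * a k) := by linarith [Real.add_one_le_exp (κ / ρ * a k)]
      have h2 : ρ + κ * a k = ρ * (1 + κ / ρ * a k) := by field_simp
      rw [h2]; exact mul_le_mul_of_nonneg_left h1 hρ.le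
    -- the weighted source sum one level up
    have hSs : ∑ j ∈ Finset.range (k + 1), ρ ^ (k + 1 - 1 - j) * r j = ρ * ∑ j ∈ Finset.range k, ρ ^ (k - 1 - j) * r j + r k := by
      rw [Finset.sum_range_succ, Finset.mul_sum, show k + 1 - 1 - k = 0 by omega, pow_zero, one_mul]
      congr 1
      refine Finset.sum_congr rfl fun j hj => ?_
      have hj' := Finset.mem_range.mp hj
      rw [show k + 1 - 1 - j = (k - 1 - j) + 1 by omega, pow_succ]; ring
    rw [hSs]
    have hpos : 0 ≤ (ρ + κ * a k) := by have := ha k; positivity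
    calc g (k + 1) ≤ (ρ + κ * a k) * g k + r k := hgs k (Nat.lt_succ_self k)
      _ ≤ (ρ * Real.exp (κ / ρ * a k)) * (Real.exp (κ / ρ * ∑ j ∈ Finset.range k, a j) * ∑ j ∈ Finset.range k, ρ ^ (k - 1 - j) * r j) + r k := by
          have := mul_le_mul hstep ihk (hg k) (by positivity)
          linarith
      _ = Real.exp (κ / ρ * ∑ j ∈ Finset.range (k + 1), a j) * (ρ * ∑ j ∈ Finset.range k, ρ ^ (k - 1 - j) * r j) + r k := by rw [hEs]; ring
      _ ≤ Real.exp (κ / ρ * ∑ j ∈ Finset.range (k + 1), a j) * (ρ * ∑ j ∈ Finset.range k, ρ ^ (k - 1 - j) * r j + r k) := by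
          have h0 : 0 ≤ r k := hr k
          nlinarith [hE1, h0]


/-! ## §2 ★ The sourced reduced family in `ℓ²` -/

section Sourced

variable (U₀ : GaugeField P 0 (Matrix.specialUnitaryGroup (Fin N) ℂ)) (R : (k : ℕ) → PBond P (k + 1) → Matrix (Fin N) (Fin N) ℂ)
  (G : (k : ℕ) → PBond P k → Matrix (Fin N) (Fin N) ℂ) (hG0 : ∀ b, G 0 b = 0)
  (hGs : ∀ (k : ℕ) (c : PBond P (k + 1)), G (k + 1) c
      = (fderiv ℂ (eml : (Idx P → Matrix (Fin N) (Fin N) ℂ) → Matrix (Fin N) (Fin N) ℂ)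
            (fun i => ((loopHol (Averaging.iter (fun i => blockAvg (P := P) (j := i) (expMeanLogSU (n := Fin N))) k U₀) c i : Matrix.specialUnitaryGroup (Fin N) ℂ) : Matrix (Fin N) (Fin N) ℂ))
            (fun i => covWalkSum (Averaging.iter (fun i => blockAvg (P := P) (j := i) (expMeanLogSU (n := Fin N))) k U₀) (G k) (walk (emb c.src) (loopWord P.L c.dir (off i.1) i.2.1 i.2.2))
              * ((loopHol (Averaging.iter (fun i => blockAvg (P := P) (j := i) (expMeanLogSU (n := Fin N))) k U₀) c i : Matrix.specialUnitaryGroup (Fin N) ℂ) : Matrix (Fin N) (Fin N) ℂ))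
            * star ((corr (expMeanLogSU (n := Fin N)) (Averaging.iter (fun i => blockAvg (P := P) (j := i) (expMeanLogSU (n := Fin N))) k U₀) c : Matrix.specialUnitaryGroup (Fin N) ℂ) : Matrix (Fin N) (Fin N) ℂ)
          + ((corr (expMeanLogSU (n := Fin N)) (Averaging.iter (fun i => blockAvg (P := P) (j := i) (expMeanLogSU (n := Fin N))) k U₀) c : Matrix.specialUnitaryGroup (Fin N) ℂ) : Matrix (Fin N) (Fin N) ℂ)
            * covWalkSum (Averaging.iter (fun i => blockAvg (P := P) (j := i) (expMeanLogSU (n := Fin N))) k U₀) (G k) (walk (emb c.src) (List.replicate P.L (c.dir, true)))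
            * star ((corr (expMeanLogSU (n := Fin N)) (Averaging.iter (fun i => blockAvg (P := P) (j := i) (expMeanLogSU (n := Fin N))) k U₀) c : Matrix.specialUnitaryGroup (Fin N) ℂ) : Matrix (Fin N) (Fin N) ℂ))
        - ((((Fintype.card (Idx P) : ℂ))⁻¹ • ∑ i : Idx P,
              covWalkSum (Averaging.iter (fun i => blockAvg (P := P) (j := i) (expMeanLogSU (n := Fin N))) k U₀) (G k) (walk (emb c.src) (stairWord i.2.1 (off i.1))))
            - ((Averaging.iter (fun i => blockAvg (P := P) (j := i) (expMeanLogSU (n := Fin N))) (k + 1) U₀ c : Matrix.specialUnitaryGroup (Fin N) ℂ) : Matrix (Fin N) (Fin N) ℂ)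
              * (((Fintype.card (Idx P) : ℂ))⁻¹ • ∑ i : Idx P,
              covWalkSum (Averaging.iter (fun i => blockAvg (P := P) (j := i) (expMeanLogSU (n := Fin N))) k U₀) (G k) (walk (emb c.tgt) (stairWord i.2.1 (off i.1))))
              * star ((Averaging.iter (fun i => blockAvg (P := P) (j := i) (expMeanLogSU (n := Fin N))) (k + 1) U₀ c : Matrix.specialUnitaryGroup (Fin N) ℂ) : Matrix (Fin N) (Fin N) ℂ))
        + R k c)

include hG0 hGs in
/-- ★ **THE SOURCED REDUCED FAMILY IN `ℓ²`**: along the tower `Ū₀^{(j)}` in the standing range `k ≤ m + K`, with per-level loop sizes `dist1(W^{(j)}_i(c)) ≤ a j ≤ 1/24`,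
`a j < δ_N` (`j < k`), the sourced reduced family at the covariant comb mean with `G 0 = 0` obeys, with `ρ = √((L^d)⁻¹L²)`, `κ = 159·(d+2)L·√((2dL^d)(2d))`,
`√(Σ_c‖G k c‖²) ≤ exp((κ/ρ)Σ_{j<k} a j)·Σ_{j<k} ρ^{k−1−j}·√(Σ_c‖R j c‖²)`. [cite: Balaban1984PropagatorsI, (1.18)-(1.20) pp.19-20; Balaban1985Averaging, Prop. 3 (124)-(126) p.36] -/
theorem sqrt_sum_normSq_sourcedReduced_le (a : ℕ → ℝ) (ha0 : ∀ j, 0 ≤ a j) {k : ℕ} (hk : k ≤ P.m + P.K)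
    (hα : ∀ j < k, ∀ (c : PBond P (j + 1)) (i : Idx P),
        dist1 (loopHol (Averaging.iter (fun i => blockAvg (P := P) (j := i) (expMeanLogSU (n := Fin N))) j U₀) c i) ≤ a j)
    (ha24 : ∀ j < k, a j ≤ 1 / 24) (haN : ∀ j < k, a j < deltaSU (Fin N)) :
    Real.sqrt (∑ c : PBond P k, ‖G k c‖ ^ 2)
      ≤ Real.exp ((159 * (((P.d + 2) * P.L : ℕ) : ℝ) * Real.sqrt (2 * P.d * (P.L : ℝ) ^ P.d * (2 * P.d))) / Real.sqrt (((P.L : ℝ) ^ P.d)⁻¹ * (P.L : ℝ) ^ 2) * ∑ j ∈ Finset.range k, a j)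
        * ∑ j ∈ Finset.range k, Real.sqrt (((P.L : ℝ) ^ P.d)⁻¹ * (P.L : ℝ) ^ 2) ^ (k - 1 - j) * Real.sqrt (∑ c : PBond P (j + 1), ‖R j c‖ ^ 2) := by
  have hLpos : (0 : ℝ) < (P.L : ℝ) := by exact_mod_cast P.L_pos
  have hcL : (0 : ℝ) < ((P.L : ℝ) ^ P.d)⁻¹ * (P.L : ℝ) ^ 2 := by positivity
  have hρpos : 0 < Real.sqrt (((P.L : ℝ) ^ P.d)⁻¹ * (P.L : ℝ) ^ 2) := Real.sqrt_pos.2 hcL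
  have hκ0 : 0 ≤ (159 * (((P.d + 2) * P.L : ℕ) : ℝ) * Real.sqrt (2 * P.d * (P.L : ℝ) ^ P.d * (2 * P.d))) := by positivity
  -- the per-level rows `g (j+1) ≤ (ρ + κ a j) g j + r j`
  have hrows : ∀ j < k, Real.sqrt (∑ c : PBond P (j + 1), ‖G (j + 1) c‖ ^ 2)
      ≤ (Real.sqrt (((P.L : ℝ) ^ P.d)⁻¹ * (P.L : ℝ) ^ 2) + (159 * (((P.d + 2) * P.L : ℕ) : ℝ) * Real.sqrt (2 * P.d * (P.L : ℝ) ^ P.d * (2 * P.d))) * a j) * Real.sqrt (∑ c : PBond P j, ‖G j c‖ ^ 2) + Real.sqrt (∑ c : PBond P (j + 1), ‖R j c‖ ^ 2) := by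
    intro j hj
    have hj1 : j + 1 ≤ P.m + P.K := by omega
    set V := Averaging.iter (fun i => blockAvg (P := P) (j := i) (expMeanLogSU (n := Fin N))) j U₀ with hV
    set D : PBond P (j + 1) → Matrix (Fin N) (Fin N) ℂ := fun c =>
      (fderiv ℂ (eml : (Idx P → Matrix (Fin N) (Fin N) ℂ) → Matrix (Fin N) (Fin N) ℂ)
            (fun i => ((loopHol V c i : Matrix.specialUnitaryGroup (Fin N) ℂ) : Matrix (Fin N) (Fin N) ℂ))
            (fun i => covWalkSum V (G j) (walk (emb c.src) (loopWord P.L c.dir (off i.1) i.2.1 i.2.2))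
              * ((loopHol V c i : Matrix.specialUnitaryGroup (Fin N) ℂ) : Matrix (Fin N) (Fin N) ℂ))
            * star ((corr (expMeanLogSU (n := Fin N)) V c : Matrix.specialUnitaryGroup (Fin N) ℂ) : Matrix (Fin N) (Fin N) ℂ)
          + ((corr (expMeanLogSU (n := Fin N)) V c : Matrix.specialUnitaryGroup (Fin N) ℂ) : Matrix (Fin N) (Fin N) ℂ)
            * covWalkSum V (G j) (walk (emb c.src) (List.replicate P.L (c.dir, true)))
            * star ((corr (expMeanLogSU (n := Fin N)) V c : Matrix.specialUnitaryGroup (Fin N) ℂ) : Matrix (Fin N) (Fin N) ℂ))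
      - ((((Fintype.card (Idx P) : ℂ))⁻¹ • ∑ i : Idx P,
              covWalkSum V (G j) (walk (emb c.src) (stairWord i.2.1 (off i.1))))
          - ((avgFun (expMeanLogSU (n := Fin N)) V c : Matrix.specialUnitaryGroup (Fin N) ℂ) : Matrix (Fin N) (Fin N) ℂ)
              * (((Fintype.card (Idx P) : ℂ))⁻¹ • ∑ i : Idx P,
              covWalkSum V (G j) (walk (emb c.tgt) (stairWord i.2.1 (off i.1))))
              * star ((avgFun (expMeanLogSU (n := Fin N)) V c : Matrix.specialUnitaryGroup (Fin N) ℂ) : Matrix (Fin N) (Fin N) ℂ))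
      - (((Fintype.card (Idx P) : ℂ))⁻¹ • ∑ i : Idx P,
          ((holAt V (walk (emb c.src) (stairWord i.2.1 (off i.1))) : Matrix.specialUnitaryGroup (Fin N) ℂ) : Matrix (Fin N) (Fin N) ℂ) *
            covWalkSum V (G j) (walk (walkEnd (emb c.src) (stairWord i.2.1 (off i.1))) (List.replicate P.L (c.dir, true))) *
          star ((holAt V (walk (emb c.src) (stairWord i.2.1 (off i.1))) : Matrix.specialUnitaryGroup (Fin N) ℂ) : Matrix (Fin N) (Fin N) ℂ)) with hD
    set LG : PBond P (j + 1) → Matrix (Fin N) (Fin N) ℂ := fun c => (((Fintype.card (Idx P) : ℂ))⁻¹ • ∑ i : Idx P,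
          ((holAt V (walk (emb c.src) (stairWord i.2.1 (off i.1))) : Matrix.specialUnitaryGroup (Fin N) ℂ) : Matrix (Fin N) (Fin N) ℂ) *
            covWalkSum V (G j) (walk (walkEnd (emb c.src) (stairWord i.2.1 (off i.1))) (List.replicate P.L (c.dir, true))) *
          star ((holAt V (walk (emb c.src) (stairWord i.2.1 (off i.1))) : Matrix.specialUnitaryGroup (Fin N) ℂ) : Matrix (Fin N) (Fin N) ℂ)) with hLG
    have hiter : Averaging.iter (fun i => blockAvg (P := P) (j := i) (expMeanLogSU (n := Fin N))) (j + 1) U₀ = avgFun (expMeanLogSU (n := Fin N)) V := rfl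
    have hdec : ∀ c, G (j + 1) c = (D c + LG c) + R j c := by
      intro c
      rw [hGs, hiter]
      simp only [hD, hLG]
      abel
    have hDrow : Real.sqrt (∑ c, ‖D c‖ ^ 2) ≤ (159 * (((P.d + 2) * P.L : ℕ) : ℝ) * Real.sqrt (2 * P.d * (P.L : ℝ) ^ P.d * (2 * P.d))) * a j * Real.sqrt (∑ c, ‖G j c‖ ^ 2) := by
      have h := sum_normSq_defect_le hj1 V (G j) (hα j hj) (ha24 j hj) (haN j hj)
      have h' : ∑ c, ‖D c‖ ^ 2 ≤ ((159 * a j * (((P.d + 2) * P.L : ℕ) : ℝ)) ^ 2 * (2 * P.d * (P.L : ℝ) ^ P.d * (2 * P.d))) * ∑ b, ‖G j b‖ ^ 2 := by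
        simpa only [hD, mul_assoc] using h
      have h1 := sqrt_le_sqrt_mul_of_sq_le (by positivity) h'
      have h2 : Real.sqrt ((159 * a j * (((P.d + 2) * P.L : ℕ) : ℝ)) ^ 2 * (2 * P.d * (P.L : ℝ) ^ P.d * (2 * P.d))) = (159 * (((P.d + 2) * P.L : ℕ) : ℝ) * Real.sqrt (2 * P.d * (P.L : ℝ) ^ P.d * (2 * P.d))) * a j := by
        rw [Real.sqrt_mul (sq_nonneg _), Real.sqrt_sq (by have := ha0 j; positivity)]
        ring
      rw [h2] at h1
      exact h1
    have hLGrow : Real.sqrt (∑ c, ‖LG c‖ ^ 2) ≤ Real.sqrt (((P.L : ℝ) ^ P.d)⁻¹ * (P.L : ℝ) ^ 2) * Real.sqrt (∑ c, ‖G j c‖ ^ 2) := by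
      have h := sum_normSq_line_le hj1 V (G j)
      exact sqrt_le_sqrt_mul_of_sq_le hcL.le (by simpa only [hLG] using h)
    calc Real.sqrt (∑ c, ‖G (j + 1) c‖ ^ 2) = Real.sqrt (∑ c, ‖(D c + LG c) + R j c‖ ^ 2) := by simp only [hdec]
      _ ≤ Real.sqrt (∑ c, ‖D c + LG c‖ ^ 2) + Real.sqrt (∑ c, ‖R j c‖ ^ 2) := sqrt_sum_norm_add_sq_le _ _
      _ ≤ (Real.sqrt (∑ c, ‖D c‖ ^ 2) + Real.sqrt (∑ c, ‖LG c‖ ^ 2)) + Real.sqrt (∑ c, ‖R j c‖ ^ 2) :=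
          add_le_add (sqrt_sum_norm_add_sq_le D LG) le_rfl
      _ ≤ ((159 * (((P.d + 2) * P.L : ℕ) : ℝ) * Real.sqrt (2 * P.d * (P.L : ℝ) ^ P.d * (2 * P.d))) * a j * Real.sqrt (∑ c, ‖G j c‖ ^ 2) + Real.sqrt (((P.L : ℝ) ^ P.d)⁻¹ * (P.L : ℝ) ^ 2) * Real.sqrt (∑ c, ‖G j c‖ ^ 2))
            + Real.sqrt (∑ c, ‖R j c‖ ^ 2) := add_le_add (add_le_add hDrow hLGrow) le_rfl
      _ = _ := by ring
  have hmain := sourced_recursion_bound hρpos hκ0 a (fun j => Real.sqrt (∑ c : PBond P j, ‖G j c‖ ^ 2))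
    (fun j => Real.sqrt (∑ c : PBond P (j + 1), ‖R j c‖ ^ 2)) ha0 (fun j => Real.sqrt_nonneg _) (fun j => Real.sqrt_nonneg _)
    (by simp [hG0]) k hrows
  exact hmain

end Sourced


/-! ## §3 The coarse gauge function of a sourced family in `ℓ²` (mass bound of the covariant comb mean) -/

/-- The covariant gradient energy is at most `4d` times the mass: `Σ_{b,ν}‖V(b₋,ν)X(b+e_ν)V(b₋,ν)* − X(b)‖² ≤ 4d·Σ_b‖X(b)‖²`. [folklore] -/
theorem sum_normSq_covGrad_le_mass {j : ℕ} (V : GaugeField P j (Matrix.specialUnitaryGroup (Fin N) ℂ)) (X : PBond P j → Matrix (Fin N) (Fin N) ℂ) :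
    ∑ b : PBond P j, ∑ ν : Fin P.d,
        ‖((V ⟨b.src, ν⟩ : Matrix.specialUnitaryGroup (Fin N) ℂ) : Matrix (Fin N) (Fin N) ℂ) * X ⟨b.src.shift ν, b.dir⟩ * star ((V ⟨b.src, ν⟩ : Matrix.specialUnitaryGroup (Fin N) ℂ) : Matrix (Fin N) (Fin N) ℂ) - X b‖ ^ 2
      ≤ 4 * P.d * ∑ b : PBond P j, ‖X b‖ ^ 2 := by
  have hpt : ∀ (b : PBond P j) (ν : Fin P.d),
      ‖((V ⟨b.src, ν⟩ : Matrix.specialUnitaryGroup (Fin N) ℂ) : Matrix (Fin N) (Fin N) ℂ) * X ⟨b.src.shift ν, b.dir⟩ * star ((V ⟨b.src, ν⟩ : Matrix.specialUnitaryGroup (Fin N) ℂ) : Matrix (Fin N) (Fin N) ℂ) - X b‖ ^ 2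
        ≤ 2 * ‖X ⟨b.src.shift ν, b.dir⟩‖ ^ 2 + 2 * ‖X b‖ ^ 2 := by
    intro b ν
    have h1 := norm_conj_su_le (V ⟨b.src, ν⟩) (X ⟨b.src.shift ν, b.dir⟩)
    have h2 := norm_sub_le (((V ⟨b.src, ν⟩ : Matrix.specialUnitaryGroup (Fin N) ℂ) : Matrix (Fin N) (Fin N) ℂ) * X ⟨b.src.shift ν, b.dir⟩ * star ((V ⟨b.src, ν⟩ : Matrix.specialUnitaryGroup (Fin N) ℂ) : Matrix (Fin N) (Fin N) ℂ)) (X b)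
    have h0 := norm_nonneg (((V ⟨b.src, ν⟩ : Matrix.specialUnitaryGroup (Fin N) ℂ) : Matrix (Fin N) (Fin N) ℂ) * X ⟨b.src.shift ν, b.dir⟩ * star ((V ⟨b.src, ν⟩ : Matrix.specialUnitaryGroup (Fin N) ℂ) : Matrix (Fin N) (Fin N) ℂ) - X b)
    have h3 : ‖((V ⟨b.src, ν⟩ : Matrix.specialUnitaryGroup (Fin N) ℂ) : Matrix (Fin N) (Fin N) ℂ) * X ⟨b.src.shift ν, b.dir⟩ * star ((V ⟨b.src, ν⟩ : Matrix.specialUnitaryGroup (Fin N) ℂ) : Matrix (Fin N) (Fin N) ℂ) - X b‖ ≤ ‖X ⟨b.src.shift ν, b.dir⟩‖ + ‖X b‖ := h2.trans (by linarith)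
    have h4 := pow_le_pow_left₀ h0 h3 2
    nlinarith [sq_nonneg (‖X ⟨b.src.shift ν, b.dir⟩‖ - ‖X b‖)]
  have hshift : ∀ ν : Fin P.d, ∑ b : PBond P j, ‖X ⟨b.src.shift ν, b.dir⟩‖ ^ 2 = ∑ b : PBond P j, ‖X b‖ ^ 2 := by
    intro ν
    rw [sum_pbond (fun b : PBond P j => ‖X ⟨b.src.shift ν, b.dir⟩‖ ^ 2), sum_pbond (fun b : PBond P j => ‖X b‖ ^ 2)]
    exact sum_shift ν (fun x => ∑ μ : Fin P.d, ‖X ⟨x, μ⟩‖ ^ 2)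
  have e1 : ∑ b : PBond P j, ∑ ν : Fin P.d, 2 * ‖X ⟨b.src.shift ν, b.dir⟩‖ ^ 2 = 2 * (P.d * ∑ b : PBond P j, ‖X b‖ ^ 2) := by
    rw [Finset.sum_comm]
    calc ∑ ν : Fin P.d, ∑ b : PBond P j, 2 * ‖X ⟨b.src.shift ν, b.dir⟩‖ ^ 2 = ∑ _ν : Fin P.d, 2 * ∑ b : PBond P j, ‖X b‖ ^ 2 :=
          Finset.sum_congr rfl fun ν _ => by rw [← Finset.mul_sum, hshift ν]
      _ = 2 * (P.d * ∑ b : PBond P j, ‖X b‖ ^ 2) := by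
          rw [Finset.sum_const, Finset.card_univ, Fintype.card_fin, nsmul_eq_mul]; ring
  have e2 : ∑ b : PBond P j, ∑ _ν : Fin P.d, 2 * ‖X b‖ ^ 2 = 2 * (P.d * ∑ b : PBond P j, ‖X b‖ ^ 2) := by
    calc ∑ b : PBond P j, ∑ _ν : Fin P.d, 2 * ‖X b‖ ^ 2 = ∑ b : PBond P j, P.d * (2 * ‖X b‖ ^ 2) :=
          Finset.sum_congr rfl fun b _ => by rw [Finset.sum_const, Finset.card_univ, Fintype.card_fin, nsmul_eq_mul]
      _ = 2 * (P.d * ∑ b : PBond P j, ‖X b‖ ^ 2) := by rw [← Finset.mul_sum, ← Finset.mul_sum]; ring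
  calc ∑ b : PBond P j, ∑ ν : Fin P.d,
        ‖((V ⟨b.src, ν⟩ : Matrix.specialUnitaryGroup (Fin N) ℂ) : Matrix (Fin N) (Fin N) ℂ) * X ⟨b.src.shift ν, b.dir⟩ * star ((V ⟨b.src, ν⟩ : Matrix.specialUnitaryGroup (Fin N) ℂ) : Matrix (Fin N) (Fin N) ℂ) - X b‖ ^ 2
      ≤ ∑ b : PBond P j, ∑ ν : Fin P.d, (2 * ‖X ⟨b.src.shift ν, b.dir⟩‖ ^ 2 + 2 * ‖X b‖ ^ 2) :=
        Finset.sum_le_sum fun b _ => Finset.sum_le_sum fun ν _ => hpt b ν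
    _ = ∑ b : PBond P j, ∑ ν : Fin P.d, 2 * ‖X ⟨b.src.shift ν, b.dir⟩‖ ^ 2 + ∑ b : PBond P j, ∑ _ν : Fin P.d, 2 * ‖X b‖ ^ 2 := by
        rw [← Finset.sum_add_distrib]
        exact Finset.sum_congr rfl fun b _ => Finset.sum_add_distrib
    _ = 4 * P.d * ∑ b : PBond P j, ‖X b‖ ^ 2 := by rw [e1, e2]; ring

/-- ★ **THE `ℓ²` MASS BOUND OF THE COVARIANT COMB MEAN** (★routeR-w2's ✓ `sum_normSq_covCombMean_le` with the gradient energy bounded by the mass): for an `SU(N)`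
background `V` of `T^{(j)}` with plaquette variables within `a′` of `1`, `√(Σ_z‖CM_j(X)(z)‖²) ≤ C_CM·√(Σ_b‖X b‖²)`, `C_CM = √(4d(d+2)²NL⁴ + 4(d+2)²d³(3N+2d)L⁶a′²)`.
[cite: Balaban1984PropagatorsI, (1.18)-(1.20) pp.19-20] -/
theorem sqrt_sum_normSq_covCombMean_le_mass {j : ℕ} (hj : j + 1 ≤ P.m + P.K) (V : GaugeField P j (Matrix.specialUnitaryGroup (Fin N) ℂ)) {a' : ℝ} (ha' : 0 ≤ a')
    (hV : ∀ q : Plaq P j, dist1 (GaugeField.plaqHol V q) ≤ a') (X : PBond P j → Matrix (Fin N) (Fin N) ℂ) :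
    Real.sqrt (∑ z : Site P (j + 1), ‖(((Fintype.card (Idx P) : ℂ))⁻¹ • ∑ i : Idx P,
              covWalkSum V X (walk (emb z) (stairWord i.2.1 (off i.1))))‖ ^ 2) ≤ Real.sqrt (4 * P.d * (((P.d : ℝ) + 2) ^ 2 * N * (P.L : ℝ) ^ 4) + (4 * ((P.d : ℝ) + 2) ^ 2 * (P.d : ℝ) ^ 3 * (3 * N + 2 * P.d) * (P.L : ℝ) ^ 6) * a' ^ 2) * Real.sqrt (∑ b : PBond P j, ‖X b‖ ^ 2) := by
  have h := sum_normSq_covCombMean_le hj V ha' hV X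
  have hg := sum_normSq_covGrad_le_mass V X
  refine sqrt_le_sqrt_mul_of_sq_le (by positivity) (h.trans ?_)
  have hA : 0 ≤ (((P.d : ℝ) + 2) ^ 2 * N * (P.L : ℝ) ^ 4) := by positivity
  have := mul_le_mul_of_nonneg_left hg hA
  nlinarith [this]

section Gauge

variable (U₀ : GaugeField P 0 (Matrix.specialUnitaryGroup (Fin N) ℂ)) (G : (k : ℕ) → PBond P k → Matrix (Fin N) (Fin N) ℂ) (Λ : (k : ℕ) → Site P k → Matrix (Fin N) (Fin N) ℂ)
  (hΛ0 : ∀ y, Λ 0 y = 0)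
  (hΛs : ∀ (k : ℕ) (z : Site P (k + 1)), Λ (k + 1) z
    = (((Fintype.card (Idx P) : ℂ))⁻¹ • ∑ i : Idx P,
              covWalkSum (Averaging.iter (fun i => blockAvg (P := P) (j := i) (expMeanLogSU (n := Fin N))) k U₀) (G k) (walk (emb z) (stairWord i.2.1 (off i.1))))
      + Λ k (emb z))

include hΛ0 hΛs in
/-- ★ **THE COARSE GAUGE FUNCTION IN `ℓ²`, SOURCE VERSION**: for the recursion of record `Λ_0 = 0`, `Λ_{j+1}(z) = CM_j(G_j)(z) + Λ_j(emb z)` along a tower whose level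
backgrounds have plaquette variables within `a′` of `1`, `√(Σ_y‖Λ_k(y)‖²) ≤ Σ_{j<k} C_CM·√(Σ_c‖G_j(c)‖²)` (`k ≤ m + K`; Minkowski over the levels, mass bound of the comb
mean — no Poincaré). [cite: Balaban1984PropagatorsI, (1.18)-(1.20) pp.19-20] -/
theorem sqrt_sum_normSq_sourcedGauge_le {a' : ℝ} (ha' : 0 ≤ a') {k : ℕ} (hk : k ≤ P.m + P.K)
    (hV : ∀ j < k, ∀ q : Plaq P j, dist1 (GaugeField.plaqHol (Averaging.iter (fun i => blockAvg (P := P) (j := i) (expMeanLogSU (n := Fin N))) j U₀) q) ≤ a') :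
    Real.sqrt (∑ y : Site P k, ‖Λ k y‖ ^ 2) ≤ ∑ j ∈ Finset.range k, Real.sqrt (4 * P.d * (((P.d : ℝ) + 2) ^ 2 * N * (P.L : ℝ) ^ 4) + (4 * ((P.d : ℝ) + 2) ^ 2 * (P.d : ℝ) ^ 3 * (3 * N + 2 * P.d) * (P.L : ℝ) ^ 6) * a' ^ 2) * Real.sqrt (∑ c : PBond P j, ‖G j c‖ ^ 2) := by
  have ht := norm_le_of_rec_eq Λ (fun j z => (((Fintype.card (Idx P) : ℂ))⁻¹ • ∑ i : Idx P,
              covWalkSum (Averaging.iter (fun i => blockAvg (P := P) (j := i) (expMeanLogSU (n := Fin N))) j U₀) (G j) (walk (emb z) (stairWord i.2.1 (off i.1))))) hΛs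
  have hmain := sqrt_sum_normSq_le_sum_levels Λ hΛ0 (fun j z => ‖(((Fintype.card (Idx P) : ℂ))⁻¹ • ∑ i : Idx P,
              covWalkSum (Averaging.iter (fun i => blockAvg (P := P) (j := i) (expMeanLogSU (n := Fin N))) j U₀) (G j) (walk (emb z) (stairWord i.2.1 (off i.1))))‖) (fun _ _ => norm_nonneg _) ht k hk
  refine hmain.trans (Finset.sum_le_sum fun j hj => ?_)
  have hjk : j < k := Finset.mem_range.mp hj
  exact sqrt_sum_normSq_covCombMean_le_mass (by omega) _ ha' (hV j hjk) (G j)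

end Gauge

/-! ## §4 ★★ The sourced family in `ℓ²` -/

/-- Coarse covariant gradients in `ℓ²`: `√(Σ_c‖Λ(c₋) − V(c)Λ(c₊)V(c)*‖²) ≤ 2√d·√(Σ_y‖Λ(y)‖²)`. [folklore] -/
theorem sqrt_sum_normSq_pureGauge_le {k : ℕ} (V : GaugeField P k (Matrix.specialUnitaryGroup (Fin N) ℂ)) (Λ : Site P k → Matrix (Fin N) (Fin N) ℂ) :
    Real.sqrt (∑ c : PBond P k, ‖Λ c.src - ((V c : Matrix.specialUnitaryGroup (Fin N) ℂ) : Matrix (Fin N) (Fin N) ℂ) * Λ c.tgt * star ((V c : Matrix.specialUnitaryGroup (Fin N) ℂ) : Matrix (Fin N) (Fin N) ℂ)‖ ^ 2)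
      ≤ 2 * Real.sqrt P.d * Real.sqrt (∑ y : Site P k, ‖Λ y‖ ^ 2) := by
  have hpt : ∀ c : PBond P k, ‖Λ c.src - ((V c : Matrix.specialUnitaryGroup (Fin N) ℂ) : Matrix (Fin N) (Fin N) ℂ) * Λ c.tgt * star ((V c : Matrix.specialUnitaryGroup (Fin N) ℂ) : Matrix (Fin N) (Fin N) ℂ)‖ ≤ ‖Λ c.src‖ + ‖Λ c.tgt‖ :=
    fun c => Prop7TrueLinIterStructure.norm_pureGauge_le V Λ c
  have h1 : Real.sqrt (∑ c : PBond P k, ‖Λ c.src - ((V c : Matrix.specialUnitaryGroup (Fin N) ℂ) : Matrix (Fin N) (Fin N) ℂ) * Λ c.tgt * star ((V c : Matrix.specialUnitaryGroup (Fin N) ℂ) : Matrix (Fin N) (Fin N) ℂ)‖ ^ 2)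
      ≤ Real.sqrt (∑ c : PBond P k, (‖Λ c.src‖ + ‖Λ c.tgt‖) ^ 2) :=
    Real.sqrt_le_sqrt (Finset.sum_le_sum fun c _ => pow_le_pow_left₀ (norm_nonneg _) (hpt c) 2)
  have h2 : ∑ c : PBond P k, (‖Λ c.src‖ + ‖Λ c.tgt‖) ^ 2 ≤ 4 * P.d * ∑ y : Site P k, ‖Λ y‖ ^ 2 := by
    calc ∑ c : PBond P k, (‖Λ c.src‖ + ‖Λ c.tgt‖) ^ 2 ≤ ∑ c : PBond P k, 2 * (‖Λ c.tgt‖ ^ 2 + ‖Λ c.src‖ ^ 2) :=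
          Finset.sum_le_sum fun c _ => by nlinarith [sq_nonneg (‖Λ c.src‖ - ‖Λ c.tgt‖)]
      _ = 4 * P.d * ∑ y : Site P k, ‖Λ y‖ ^ 2 := by rw [← Finset.mul_sum, sum_pbond_tgt_add_src (fun y => ‖Λ y‖ ^ 2)]; ring
  have hd0 : (0 : ℝ) ≤ P.d := Nat.cast_nonneg _
  have h3 : Real.sqrt (∑ c : PBond P k, (‖Λ c.src‖ + ‖Λ c.tgt‖) ^ 2) ≤ 2 * Real.sqrt P.d * Real.sqrt (∑ y : Site P k, ‖Λ y‖ ^ 2) := by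
    refine (Real.sqrt_le_sqrt h2).trans (le_of_eq ?_)
    rw [show (4 : ℝ) * P.d * ∑ y : Site P k, ‖Λ y‖ ^ 2 = 2 ^ 2 * ((P.d : ℝ) * ∑ y : Site P k, ‖Λ y‖ ^ 2) by ring,
      Real.sqrt_mul (by norm_num), Real.sqrt_sq (by norm_num), Real.sqrt_mul hd0]
    ring
  exact h1.trans h3

section Assembly

variable (U₀ : GaugeField P 0 (Matrix.specialUnitaryGroup (Fin N) ℂ)) (R : (k : ℕ) → PBond P (k + 1) → Matrix (Fin N) (Fin N) ℂ)
  (D : (k : ℕ) → PBond P k → Matrix (Fin N) (Fin N) ℂ) (hD0 : ∀ b, D 0 b = 0)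
  (hDs : ∀ (k : ℕ) (c : PBond P (k + 1)), D (k + 1) c = (fderiv ℂ (eml : (Idx P → Matrix (Fin N) (Fin N) ℂ) → Matrix (Fin N) (Fin N) ℂ)
            (fun i => ((loopHol (Averaging.iter (fun i => blockAvg (P := P) (j := i) (expMeanLogSU (n := Fin N))) k U₀) c i : Matrix.specialUnitaryGroup (Fin N) ℂ) : Matrix (Fin N) (Fin N) ℂ))
            (fun i => covWalkSum (Averaging.iter (fun i => blockAvg (P := P) (j := i) (expMeanLogSU (n := Fin N))) k U₀) (D k) (walk (emb c.src) (loopWord P.L c.dir (off i.1) i.2.1 i.2.2))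
              * ((loopHol (Averaging.iter (fun i => blockAvg (P := P) (j := i) (expMeanLogSU (n := Fin N))) k U₀) c i : Matrix.specialUnitaryGroup (Fin N) ℂ) : Matrix (Fin N) (Fin N) ℂ))
            * star ((corr (expMeanLogSU (n := Fin N)) (Averaging.iter (fun i => blockAvg (P := P) (j := i) (expMeanLogSU (n := Fin N))) k U₀) c : Matrix.specialUnitaryGroup (Fin N) ℂ) : Matrix (Fin N) (Fin N) ℂ)
          + ((corr (expMeanLogSU (n := Fin N)) (Averaging.iter (fun i => blockAvg (P := P) (j := i) (expMeanLogSU (n := Fin N))) k U₀) c : Matrix.specialUnitaryGroup (Fin N) ℂ) : Matrix (Fin N) (Fin N) ℂ)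
            * covWalkSum (Averaging.iter (fun i => blockAvg (P := P) (j := i) (expMeanLogSU (n := Fin N))) k U₀) (D k) (walk (emb c.src) (List.replicate P.L (c.dir, true)))
            * star ((corr (expMeanLogSU (n := Fin N)) (Averaging.iter (fun i => blockAvg (P := P) (j := i) (expMeanLogSU (n := Fin N))) k U₀) c : Matrix.specialUnitaryGroup (Fin N) ℂ) : Matrix (Fin N) (Fin N) ℂ)) + R k c)
  (G : (k : ℕ) → PBond P k → Matrix (Fin N) (Fin N) ℂ) (hG0 : ∀ b, G 0 b = 0)
  (hGs : ∀ (k : ℕ) (c : PBond P (k + 1)), G (k + 1) c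
      = (fderiv ℂ (eml : (Idx P → Matrix (Fin N) (Fin N) ℂ) → Matrix (Fin N) (Fin N) ℂ)
            (fun i => ((loopHol (Averaging.iter (fun i => blockAvg (P := P) (j := i) (expMeanLogSU (n := Fin N))) k U₀) c i : Matrix.specialUnitaryGroup (Fin N) ℂ) : Matrix (Fin N) (Fin N) ℂ))
            (fun i => covWalkSum (Averaging.iter (fun i => blockAvg (P := P) (j := i) (expMeanLogSU (n := Fin N))) k U₀) (G k) (walk (emb c.src) (loopWord P.L c.dir (off i.1) i.2.1 i.2.2))
              * ((loopHol (Averaging.iter (fun i => blockAvg (P := P) (j := i) (expMeanLogSU (n := Fin N))) k U₀) c i : Matrix.specialUnitaryGroup (Fin N) ℂ) : Matrix (Fin N) (Fin N) ℂ))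
            * star ((corr (expMeanLogSU (n := Fin N)) (Averaging.iter (fun i => blockAvg (P := P) (j := i) (expMeanLogSU (n := Fin N))) k U₀) c : Matrix.specialUnitaryGroup (Fin N) ℂ) : Matrix (Fin N) (Fin N) ℂ)
          + ((corr (expMeanLogSU (n := Fin N)) (Averaging.iter (fun i => blockAvg (P := P) (j := i) (expMeanLogSU (n := Fin N))) k U₀) c : Matrix.specialUnitaryGroup (Fin N) ℂ) : Matrix (Fin N) (Fin N) ℂ)
            * covWalkSum (Averaging.iter (fun i => blockAvg (P := P) (j := i) (expMeanLogSU (n := Fin N))) k U₀) (G k) (walk (emb c.src) (List.replicate P.L (c.dir, true)))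
            * star ((corr (expMeanLogSU (n := Fin N)) (Averaging.iter (fun i => blockAvg (P := P) (j := i) (expMeanLogSU (n := Fin N))) k U₀) c : Matrix.specialUnitaryGroup (Fin N) ℂ) : Matrix (Fin N) (Fin N) ℂ))
        - ((((Fintype.card (Idx P) : ℂ))⁻¹ • ∑ i : Idx P,
              covWalkSum (Averaging.iter (fun i => blockAvg (P := P) (j := i) (expMeanLogSU (n := Fin N))) k U₀) (G k) (walk (emb c.src) (stairWord i.2.1 (off i.1))))
            - ((Averaging.iter (fun i => blockAvg (P := P) (j := i) (expMeanLogSU (n := Fin N))) (k + 1) U₀ c : Matrix.specialUnitaryGroup (Fin N) ℂ) : Matrix (Fin N) (Fin N) ℂ)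
              * (((Fintype.card (Idx P) : ℂ))⁻¹ • ∑ i : Idx P,
              covWalkSum (Averaging.iter (fun i => blockAvg (P := P) (j := i) (expMeanLogSU (n := Fin N))) k U₀) (G k) (walk (emb c.tgt) (stairWord i.2.1 (off i.1))))
              * star ((Averaging.iter (fun i => blockAvg (P := P) (j := i) (expMeanLogSU (n := Fin N))) (k + 1) U₀ c : Matrix.specialUnitaryGroup (Fin N) ℂ) : Matrix (Fin N) (Fin N) ℂ))
        + R k c)
  (Λ : (k : ℕ) → Site P k → Matrix (Fin N) (Fin N) ℂ) (hΛ0 : ∀ y, Λ 0 y = 0)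
  (hΛs : ∀ (k : ℕ) (z : Site P (k + 1)), Λ (k + 1) z
    = (((Fintype.card (Idx P) : ℂ))⁻¹ • ∑ i : Idx P,
              covWalkSum (Averaging.iter (fun i => blockAvg (P := P) (j := i) (expMeanLogSU (n := Fin N))) k U₀) (G k) (walk (emb z) (stairWord i.2.1 (off i.1))))
      + Λ k (emb z))

include hD0 hDs hG0 hGs hΛ0 hΛs in
/-- ★★ **THE SOURCED FAMILY IN `ℓ²`.**  `D_0 = 0`, `D_{j+1} = T_jD_j + R_j` along the tower `Ū₀^{(j)}` (`k ≤ m + K`); `G`, `Λ` the sourced reduced family and the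
coarse gauge function of record (file A1); per-level loop sizes `dist1(W^{(j)}_i(c)) ≤ a j ≤ 1/24`, `a j < δ_N`, and plaquette sizes `dist1(Ū₀^{(j)}(∂q)) ≤ a′` (`j < k`).
Then with `ρ = √((L^d)⁻¹L²)`, `κ = 159·(d+2)L·√((2dL^d)(2d))`, `C_CM = √(4d(d+2)²NL⁴ + 4(d+2)²d³(3N+2d)L⁶a′²)`, `E_j = exp((κ/ρ)Σ_{i<j}a i)`,
`S_j = Σ_{i<j}ρ^{j−1−i}√(Σ_c‖R i c‖²)`:  `√(Σ_c‖D k c‖²) ≤ E_k·S_k + 2√d·Σ_{j<k} C_CM·(E_j·S_j)`.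
[cite: Balaban1984PropagatorsI, (1.18)-(1.20) pp.19-20; Balaban1985Averaging, Prop. 3 (124)-(126) p.36] -/
theorem sqrt_sum_normSq_sourced_le (a : ℕ → ℝ) (ha0 : ∀ j, 0 ≤ a j) {a' : ℝ} (ha' : 0 ≤ a') {k : ℕ} (hk : k ≤ P.m + P.K)
    (hα : ∀ j < k, ∀ (c : PBond P (j + 1)) (i : Idx P),
        dist1 (loopHol (Averaging.iter (fun i => blockAvg (P := P) (j := i) (expMeanLogSU (n := Fin N))) j U₀) c i) ≤ a j)
    (ha24 : ∀ j < k, a j ≤ 1 / 24) (haN : ∀ j < k, a j < deltaSU (Fin N))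
    (hV : ∀ j < k, ∀ q : Plaq P j, dist1 (GaugeField.plaqHol (Averaging.iter (fun i => blockAvg (P := P) (j := i) (expMeanLogSU (n := Fin N))) j U₀) q) ≤ a') :
    Real.sqrt (∑ c : PBond P k, ‖D k c‖ ^ 2)
      ≤ Real.exp ((159 * (((P.d + 2) * P.L : ℕ) : ℝ) * Real.sqrt (2 * P.d * (P.L : ℝ) ^ P.d * (2 * P.d))) / Real.sqrt (((P.L : ℝ) ^ P.d)⁻¹ * (P.L : ℝ) ^ 2) * ∑ i ∈ Finset.range k, a i) * (∑ i ∈ Finset.range k, Real.sqrt (((P.L : ℝ) ^ P.d)⁻¹ * (P.L : ℝ) ^ 2) ^ (k - 1 - i) * Real.sqrt (∑ c : PBond P (i + 1), ‖R i c‖ ^ 2))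
        + 2 * Real.sqrt P.d * ∑ j ∈ Finset.range k, Real.sqrt (4 * P.d * (((P.d : ℝ) + 2) ^ 2 * N * (P.L : ℝ) ^ 4) + (4 * ((P.d : ℝ) + 2) ^ 2 * (P.d : ℝ) ^ 3 * (3 * N + 2 * P.d) * (P.L : ℝ) ^ 6) * a' ^ 2) * (Real.exp ((159 * (((P.d + 2) * P.L : ℕ) : ℝ) * Real.sqrt (2 * P.d * (P.L : ℝ) ^ P.d * (2 * P.d))) / Real.sqrt (((P.L : ℝ) ^ P.d)⁻¹ * (P.L : ℝ) ^ 2) * ∑ i ∈ Finset.range j, a i) * (∑ i ∈ Finset.range j, Real.sqrt (((P.L : ℝ) ^ P.d)⁻¹ * (P.L : ℝ) ^ 2) ^ (j - 1 - i) * Real.sqrt (∑ c : PBond P (i + 1), ‖R i c‖ ^ 2))) := by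
  -- the (0.4) guards from the loop sizes
  have hg : ∀ j < k, ∀ (c : PBond P (j + 1)) (i : Idx P),
      dist1 (loopHol (Averaging.iter (fun i => blockAvg (P := P) (j := i) (expMeanLogSU (n := Fin N))) j U₀) c i) < deltaSU (Fin N) :=
    fun j hj c i => (hα j hj c i).trans_lt (haN j hj)
  -- pointwise split, then Minkowski
  have hpt : ∀ c : PBond P k, ‖D k c‖ ≤ ‖G k c‖ + (‖Λ k c.src‖ + ‖Λ k c.tgt‖) := fun c => by
    have h := norm_le_of_sourced_structure U₀ D R hDs
      (fun k Gk z => ((Fintype.card (Idx P) : ℂ))⁻¹ • ∑ i : Idx P,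
        covWalkSum (Averaging.iter (fun i => blockAvg (P := P) (j := i) (expMeanLogSU (n := Fin N))) k U₀) Gk (walk (emb z) (stairWord i.2.1 (off i.1))))
      G Λ (fun b => by rw [hG0, hD0]) hΛ0 hΛs hGs hg c
    linarith
  have h1 : Real.sqrt (∑ c : PBond P k, ‖D k c‖ ^ 2) ≤ Real.sqrt (∑ c : PBond P k, (‖G k c‖ + (‖Λ k c.src‖ + ‖Λ k c.tgt‖)) ^ 2) :=
    Real.sqrt_le_sqrt (Finset.sum_le_sum fun c _ => pow_le_pow_left₀ (norm_nonneg _) (hpt c) 2)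
  have h2 := sqrt_sum_sq_add_le (Finset.univ : Finset (PBond P k)) (fun c => ‖G k c‖) (fun c => ‖Λ k c.src‖ + ‖Λ k c.tgt‖)
    (fun c _ => norm_nonneg _) (fun c _ => by positivity)
  -- `√Σ_c(‖Λ c₋‖ + ‖Λ c₊‖)² ≤ 2√d·√Σ_y‖Λ y‖²`
  have h3sq : ∑ c : PBond P k, (‖Λ k c.src‖ + ‖Λ k c.tgt‖) ^ 2 ≤ 4 * P.d * ∑ y : Site P k, ‖Λ k y‖ ^ 2 := by
    calc ∑ c : PBond P k, (‖Λ k c.src‖ + ‖Λ k c.tgt‖) ^ 2 ≤ ∑ c : PBond P k, 2 * (‖Λ k c.tgt‖ ^ 2 + ‖Λ k c.src‖ ^ 2) :=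
          Finset.sum_le_sum fun c _ => by nlinarith [sq_nonneg (‖Λ k c.src‖ - ‖Λ k c.tgt‖)]
      _ = 4 * P.d * ∑ y : Site P k, ‖Λ k y‖ ^ 2 := by rw [← Finset.mul_sum, sum_pbond_tgt_add_src (fun y => ‖Λ k y‖ ^ 2)]; ring
  have hd0 : (0 : ℝ) ≤ P.d := Nat.cast_nonneg _
  have h3 : Real.sqrt (∑ c : PBond P k, (‖Λ k c.src‖ + ‖Λ k c.tgt‖) ^ 2) ≤ 2 * Real.sqrt P.d * Real.sqrt (∑ y : Site P k, ‖Λ k y‖ ^ 2) := by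
    refine (Real.sqrt_le_sqrt h3sq).trans (le_of_eq ?_)
    rw [show (4 : ℝ) * P.d * ∑ y : Site P k, ‖Λ k y‖ ^ 2 = 2 ^ 2 * ((P.d : ℝ) * ∑ y : Site P k, ‖Λ k y‖ ^ 2) by ring,
      Real.sqrt_mul (by norm_num), Real.sqrt_sq (by norm_num), Real.sqrt_mul hd0]
    ring
  -- the two `ℓ²` bounds
  have hG := sqrt_sum_normSq_sourcedReduced_le U₀ R G hG0 hGs a ha0 hk hα ha24 haN
  have hGj : ∀ j ∈ Finset.range k, Real.sqrt (∑ c : PBond P j, ‖G j c‖ ^ 2) ≤ Real.exp ((159 * (((P.d + 2) * P.L : ℕ) : ℝ) * Real.sqrt (2 * P.d * (P.L : ℝ) ^ P.d * (2 * P.d))) / Real.sqrt (((P.L : ℝ) ^ P.d)⁻¹ * (P.L : ℝ) ^ 2) * ∑ i ∈ Finset.range j, a i) * (∑ i ∈ Finset.range j, Real.sqrt (((P.L : ℝ) ^ P.d)⁻¹ * (P.L : ℝ) ^ 2) ^ (j - 1 - i) * Real.sqrt (∑ c : PBond P (i + 1), ‖R i c‖ ^ 2)) := by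
    intro j hj
    have hjk := Finset.mem_range.mp hj
    exact sqrt_sum_normSq_sourcedReduced_le U₀ R G hG0 hGs a ha0 (hjk.le.trans hk) (fun i hi => hα i (hi.trans hjk))
      (fun i hi => ha24 i (hi.trans hjk)) (fun i hi => haN i (hi.trans hjk))
  have hΛ := sqrt_sum_normSq_sourcedGauge_le U₀ G Λ hΛ0 hΛs ha' hk hV
  have hC0 : 0 ≤ Real.sqrt (4 * P.d * (((P.d : ℝ) + 2) ^ 2 * N * (P.L : ℝ) ^ 4) + (4 * ((P.d : ℝ) + 2) ^ 2 * (P.d : ℝ) ^ 3 * (3 * N + 2 * P.d) * (P.L : ℝ) ^ 6) * a' ^ 2) := Real.sqrt_nonneg _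
  have hΛ' : Real.sqrt (∑ y : Site P k, ‖Λ k y‖ ^ 2) ≤ ∑ j ∈ Finset.range k, Real.sqrt (4 * P.d * (((P.d : ℝ) + 2) ^ 2 * N * (P.L : ℝ) ^ 4) + (4 * ((P.d : ℝ) + 2) ^ 2 * (P.d : ℝ) ^ 3 * (3 * N + 2 * P.d) * (P.L : ℝ) ^ 6) * a' ^ 2) * (Real.exp ((159 * (((P.d + 2) * P.L : ℕ) : ℝ) * Real.sqrt (2 * P.d * (P.L : ℝ) ^ P.d * (2 * P.d))) / Real.sqrt (((P.L : ℝ) ^ P.d)⁻¹ * (P.L : ℝ) ^ 2) * ∑ i ∈ Finset.range j, a i) * (∑ i ∈ Finset.range j, Real.sqrt (((P.L : ℝ) ^ P.d)⁻¹ * (P.L : ℝ) ^ 2) ^ (j - 1 - i) * Real.sqrt (∑ c : PBond P (i + 1), ‖R i c‖ ^ 2))) :=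
    hΛ.trans (Finset.sum_le_sum fun j hj => mul_le_mul_of_nonneg_left (hGj j hj) hC0)
  have hsd : 0 ≤ Real.sqrt (P.d : ℝ) := Real.sqrt_nonneg _
  nlinarith [h1, h2, h3, hG, hΛ', hsd, mul_le_mul_of_nonneg_left hΛ' hsd]

end Assembly

end Summit.QuantumFields.YangMills.Theorems.Prop7TrueLinSourcedDefect

end
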